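import Summits.RiemannHypothesis.RiemannHypothesis.Theorems.JensenLogBandCanaryCert
import Summits.RiemannHypothesis.RiemannHypothesis.Theorems.JensenLogBandCanaryAnalytic
import Summits.RiemannHypothesis.RiemannHypothesis.Theorems.JensenLogBandCanaryLists
import Summits.RiemannHypothesis.RiemannHypothesis.Theorems.JensenLogBandCanaryAssembly
import Summits.RiemannHypothesis.RiemannHypothesis.Theorems.JensenLogBandXiDerivEdgeRealCounting
import Summits.RiemannHypothesis.RiemannHypothesis.Theorems.JensenPolynomialsLogBandXiDerivRightHalfPlane
import Mathlib.Analysis.Complex.ExponentialBounds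

/-!
# E-CANARY-128 — D3 file 9b/9: from contract facts to step rules on the four edges (incl. the conjugate halves)

RH-FREE. `StepRuleContract` / `AxisContract` (the analytic contract of `…CanaryDefs`, discharged in
`…CanaryAnalytic`); `canaryF` is entire, real on `ℝ`, conjugation-symmetric (`LogBand.iteratedDeriv_xiSq_conj`) and
`canaryF z = 0 ↔ ξ₁⁽¹²⁸⁾(z) = 0`; integer segments `ISeg` (doubled coordinates), their realisation `toSeg`, the chain
checker `chainedI`; the four segment builders `vUpperI / vLowerI / hTopI / hBotI` from the row tables of
`…CanaryCertRows`; and the per-segment step rules `stepRule_vUpper / vLower / hTop / hBot` (lower and bottom = mirror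
images via conjugation, labels `3d`). Used by `…CanaryFinal`. Nothing here bears on the truth of RH.
-/

-- D-0017: the doubled namespace is by design.
set_option linter.dupNamespace false
set_option autoImplicit false

noncomputable section

namespace Summit.RiemannHypothesis.RiemannHypothesis.Theorems.JensenPolynomials.LogBand.Canary

open Summit.RiemannHypothesis.RiemannHypothesis.Theorems.JensenPolynomials.CoeffTable (Iv lk RatioEncloses)
open Summit.RiemannHypothesis.RiemannHypothesis.Theorems.JensenPolynomials.LogBand
  (iteratedDeriv_xiSq_conj im_iteratedDeriv_xiSq_ofReal iteratedDeriv_xiSq_ne_zero_of_re_nonneg)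
open Literature.NumberTheory.LFunctions (xiSq xiTaylorCoeff xiTaylorCoeff_pos_holds differentiable_xiSq)
open Literature.Analysis.Complex Complex Set
open scoped Real ComplexConjugate

/-! ## The contract lemmas as hypotheses (supplied by `…CanaryAnalytic`) -/

/-- The step-rule contract: `PieceIneq` forces `0 < Re (canaryF z / I^d)` on the closed disc of radius `L/2` about
the piece centre. -/
def StepRuleContract : Prop :=
  ∀ (a b : ℤ) (L d K N J xbar : ℕ), PieceIneq a b L d K N J xbar →
    ∀ z : ℂ, ‖z - pieceCentre a b‖ ≤ (L : ℝ) / 2 → 0 < (canaryF z / I ^ d).re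

/-- The axis contract: `AxisIneq` forces `0 < Re (canaryF (a/2) / I^d)`. -/
def AxisContract : Prop :=
  ∀ (a : ℤ) (d N xbar : ℕ), AxisIneq a d N xbar → 0 < (canaryF (pieceCentre a 0) / I ^ d).re

/-! ## `canaryF`: entire, real on `ℝ`, conjugation-symmetric, zero-free on `Re z ≥ 0` -/

/-- `canaryF` is entire. -/
theorem differentiable_canaryF : Differentiable ℂ canaryF := by
  unfold canaryF
  exact ((differentiable_iteratedDeriv_of_entire differentiable_xiSq 128).const_mul 8).div_const _

/-- `canaryF (conj z) = conj (canaryF z)`. -/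
theorem canaryF_conj (z : ℂ) : canaryF (conj z) = conj (canaryF z) := by
  unfold canaryF
  rw [iteratedDeriv_xiSq_conj, map_div₀, map_mul, Complex.conj_ofReal, map_ofNat]

/-- `canaryF` is real on the real axis. -/
theorem canaryF_im_ofReal (s : ℝ) : (canaryF s).im = 0 := by
  rw [← Complex.conj_eq_iff_im, ← canaryF_conj, Complex.conj_ofReal]

/-- `canaryF z = 0 ↔ ξ₁⁽¹²⁸⁾(z) = 0`. -/
theorem canaryF_eq_zero_iff (z : ℂ) : canaryF z = 0 ↔ iteratedDeriv 128 xiSq z = 0 := by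
  unfold canaryF
  have hγ : (xiTaylorCoeff 128 : ℂ) ≠ 0 := by exact_mod_cast (xiTaylorCoeff_pos_holds 128).ne'
  rw [div_eq_zero_iff, mul_eq_zero]
  simp [hγ]

/-- The conjugate-label step rule: `Re (conj w / I^{3d}) = Re (w / I^d)`. -/
theorem re_conj_div_I_pow (w : ℂ) (d : ℕ) : (conj w / I ^ (3 * d)).re = (w / I ^ d).re := by
  have h : I ^ (3 * d) = conj (I ^ d) := by
    rw [map_pow, Complex.conj_I, pow_mul]
    congr 1
    rw [pow_succ, pow_two, Complex.I_mul_I]; ring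
  rw [h, ← map_div₀, Complex.conj_re]

/-! ## Integer segments and their realisation -/

/-- An integer segment `(2s, 2e, d)` (doubled coordinates). -/
abbrev ISeg := ℤ × ℤ × ℕ

/-- Realisation of an integer segment. -/
def toSeg (g : ISeg) : Seg := ((g.1 : ℝ) / 2, (g.2.1 : ℝ) / 2, g.2.2)

/-- Chaining check in doubled integer coordinates. -/
def chainedI : ℤ → List ISeg → Bool
  | _, [] => true
  | y₀, (s, e, _) :: T => decide (s = y₀) && decide (s ≤ e) && chainedI e T

/-- The last endpoint (doubled). -/
def lastI (y₀ : ℤ) : List ISeg → ℤ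
  | [] => y₀
  | (_, e, _) :: T => lastI e T

/-- `chainedI` gives `Chained` for the realised list. -/
theorem chained_toSeg : ∀ (y₀ : ℤ) (T : List ISeg), chainedI y₀ T = true → Chained ((y₀ : ℝ) / 2) (T.map toSeg)
  | _, [], _ => trivial
  | y₀, (s, e, d) :: T, h => by
    simp only [chainedI, Bool.and_eq_true, decide_eq_true_eq] at h
    obtain ⟨⟨hs, _⟩, hT⟩ := h
    show Chained _ ((((s : ℝ)) / 2, ((e : ℝ)) / 2, d) :: T.map toSeg)
    exact ⟨by rw [hs], chained_toSeg e T hT⟩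

/-- `chainedI` gives `s ≤ e` for every realised segment. -/
theorem le_of_chainedI : ∀ (y₀ : ℤ) (T : List ISeg), chainedI y₀ T = true → ∀ g ∈ T, (toSeg g).1 ≤ (toSeg g).2.1
  | _, [], _, g, hg => by simp at hg
  | y₀, (s, e, d) :: T, h, g, hg => by
    simp only [chainedI, Bool.and_eq_true, decide_eq_true_eq] at h
    obtain ⟨⟨_, hse⟩, hT⟩ := h
    rcases List.mem_cons.1 hg with rfl | hg'
    · simp only [toSeg]
      have : (s : ℝ) ≤ (e : ℝ) := by exact_mod_cast hse
      linarith
    · exact le_of_chainedI e T hT g hg'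

/-- `chainedI` gives `s ≤ e` for every segment of the realised list. -/
theorem le_of_chainedI' (y₀ : ℤ) (T : List ISeg) (h : chainedI y₀ T = true) :
    ∀ g ∈ T.map toSeg, g.1 ≤ g.2.1 := by
  intro g hg
  obtain ⟨g0, hg0, rfl⟩ := List.mem_map.1 hg
  exact le_of_chainedI y₀ T h g0 hg0

/-- Last endpoint of the realised list. -/
theorem segLast_toSeg : ∀ (y₀ : ℤ) (T : List ISeg), segLast ((y₀ : ℝ) / 2) (T.map toSeg) = ((lastI y₀ T : ℤ) : ℝ) / 2
  | _, [] => rfl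
  | _, (_, e, _) :: T => by simp [segLast, lastI, toSeg, segLast_toSeg e T]

/-- Labels of the realised list. -/
theorem segLabels_toSeg : ∀ (T : List ISeg), segLabels (T.map toSeg) = T.map (fun g => g.2.2)
  | [] => rfl
  | (_, _, _) :: T => by simp [segLabels, toSeg, segLabels_toSeg T]

/-! ## The four edge lists of the certificate (doubled coordinates) -/

/-- Upper segments of a vertical table: `(b − L, b + L, d)` per row. -/
def vUpperI (t : Array ℤ) (n : ℕ) : List ISeg :=
  (List.range n).map fun i => (rowB t i - rowL t i, rowB t i + rowL t i, rowD t i)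

/-- Lower (mirrored) segments of a vertical table, listed upward from `−(top)`: `(−(b+L), −(b−L), 3d)` per row,
rows in reverse order. -/
def vLowerI (t : Array ℤ) (n : ℕ) : List ISeg :=
  ((List.range n).reverse).map fun i => (-(rowB t i + rowL t i), -(rowB t i - rowL t i), 3 * rowD t i)

/-- Top segments of a horizontal table: `(a − L, a + L, d)` per row. -/
def hTopI (t : Array ℤ) (n : ℕ) : List ISeg :=
  (List.range n).map fun i => (rowA t i - rowL t i, rowA t i + rowL t i, rowD t i)

/-- Bottom (conjugate) segments: same intervals, labels `3d`. -/
def hBotI (t : Array ℤ) (n : ℕ) : List ISeg :=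
  (List.range n).map fun i => (rowA t i - rowL t i, rowA t i + rowL t i, 3 * rowD t i)

/-! ## Per-segment step rules from the contract facts -/

/-- Distance from a point of a vertical segment to the piece centre. -/
theorem norm_sub_centre_vertical (a b : ℤ) (L : ℕ) {y : ℝ}
    (hy : y ∈ Icc ((((b - L : ℤ)) : ℝ) / 2) ((((b + L : ℤ)) : ℝ) / 2)) :
    ‖((((a : ℝ) / 2 : ℝ) : ℂ) + (y : ℂ) * I) - pieceCentre a b‖ ≤ (L : ℝ) / 2 := by
  rw [pieceCentre_eq]
  have : ((((a : ℝ) / 2 : ℝ) : ℂ) + (y : ℂ) * I) - ((((a : ℝ) / 2 : ℝ) : ℂ) + (((b : ℝ) / 2 : ℝ) : ℂ) * I)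
      = (((y - (b : ℝ) / 2 : ℝ)) : ℂ) * I := by push_cast; ring
  rw [this, norm_mul, Complex.norm_I, mul_one, Complex.norm_real, Real.norm_eq_abs, abs_le]
  obtain ⟨h1, h2⟩ := hy
  push_cast at h1 h2
  constructor <;> linarith

/-- Distance from a point of a horizontal segment to the piece centre. -/
theorem norm_sub_centre_horizontal (a b : ℤ) (L : ℕ) {x : ℝ}
    (hx : x ∈ Icc ((((a - L : ℤ)) : ℝ) / 2) ((((a + L : ℤ)) : ℝ) / 2)) :
    ‖((x : ℂ) + ((((b : ℝ) / 2 : ℝ)) : ℂ) * I) - pieceCentre a b‖ ≤ (L : ℝ) / 2 := by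
  rw [pieceCentre_eq]
  have : ((x : ℂ) + ((((b : ℝ) / 2 : ℝ)) : ℂ) * I) - ((((a : ℝ) / 2 : ℝ) : ℂ) + (((b : ℝ) / 2 : ℝ) : ℂ) * I)
      = (((x - (a : ℝ) / 2 : ℝ)) : ℂ) := by push_cast; ring
  rw [this, Complex.norm_real, Real.norm_eq_abs, abs_le]
  obtain ⟨h1, h2⟩ := hx
  push_cast at h1 h2
  constructor <;> linarith

/-- Step rules on the UPPER vertical segments (edge `Re z = a/2`, table rows all with first coordinate `a`). -/
theorem stepRule_vUpper (hstep : StepRuleContract) {t : Array ℤ} {n : ℕ} {a : ℤ} {J : ℕ}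
    (hrowA : ∀ i, i < n → rowA t i = a)
    (hP : ∀ i, i < n → PieceIneq (rowA t i) (rowB t i) (rowL t i) (rowD t i) (rowK t i) (rowN t i) J (rowX t i)) :
    ∀ g ∈ (vUpperI t n).map toSeg, ∀ y ∈ Icc g.1 g.2.1, 0 < (canaryF ((((a : ℝ) / 2 : ℝ) : ℂ) + y * I) / I ^ g.2.2).re := by
  intro g hg y hy
  simp only [vUpperI, List.map_map, List.mem_map, List.mem_range, Function.comp_apply] at hg
  obtain ⟨i, hi, rfl⟩ := hg
  simp only [toSeg] at hy ⊢
  have h := hstep _ _ _ _ _ _ _ _ (hP i hi) ((((a : ℝ) / 2 : ℝ) : ℂ) + y * I)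
    (by rw [← hrowA i hi]; exact norm_sub_centre_vertical _ _ _ hy)
  exact h

/-- Step rules on the LOWER (mirrored) vertical segments. -/
theorem stepRule_vLower (hstep : StepRuleContract) {t : Array ℤ} {n : ℕ} {a : ℤ} {J : ℕ}
    (hrowA : ∀ i, i < n → rowA t i = a)
    (hP : ∀ i, i < n → PieceIneq (rowA t i) (rowB t i) (rowL t i) (rowD t i) (rowK t i) (rowN t i) J (rowX t i)) :
    ∀ g ∈ (vLowerI t n).map toSeg, ∀ y ∈ Icc g.1 g.2.1, 0 < (canaryF ((((a : ℝ) / 2 : ℝ) : ℂ) + y * I) / I ^ g.2.2).re := by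
  intro g hg y hy
  simp only [vLowerI, List.map_map, List.mem_map, List.mem_reverse, List.mem_range, Function.comp_apply] at hg
  obtain ⟨i, hi, rfl⟩ := hg
  simp only [toSeg] at hy ⊢
  -- the conjugate point lies on the upper segment of row i
  have hy' : -y ∈ Icc ((((rowB t i - rowL t i : ℤ)) : ℝ) / 2) ((((rowB t i + rowL t i : ℤ)) : ℝ) / 2) := by
    obtain ⟨h1, h2⟩ := hy; push_cast at h1 h2 ⊢; constructor <;> linarith
  have h := hstep _ _ _ _ _ _ _ _ (hP i hi) ((((a : ℝ) / 2 : ℝ) : ℂ) + (((-y : ℝ)) : ℂ) * I)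
    (by rw [← hrowA i hi]; exact norm_sub_centre_vertical _ _ _ hy')
  have hconj : conj (((((a : ℝ) / 2 : ℝ) : ℂ) + (((-y : ℝ)) : ℂ) * I)) = (((a : ℝ) / 2 : ℝ) : ℂ) + (y : ℂ) * I := by
    simp only [map_add, map_mul, Complex.conj_ofReal, Complex.conj_I]; push_cast; ring
  rw [← re_conj_div_I_pow, ← canaryF_conj, hconj] at h
  exact h

/-- Step rules on the TOP horizontal segments (edge `Im z = b/2`, rows all with second coordinate `b`). -/
theorem stepRule_hTop (hstep : StepRuleContract) {t : Array ℤ} {n : ℕ} {b : ℤ} {J : ℕ}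
    (hrowB : ∀ i, i < n → rowB t i = b)
    (hP : ∀ i, i < n → PieceIneq (rowA t i) (rowB t i) (rowL t i) (rowD t i) (rowK t i) (rowN t i) J (rowX t i)) :
    ∀ g ∈ (hTopI t n).map toSeg, ∀ x ∈ Icc g.1 g.2.1, 0 < (canaryF ((x : ℂ) + (((b : ℝ) / 2 : ℝ) : ℂ) * I) / I ^ g.2.2).re := by
  intro g hg x hx
  simp only [hTopI, List.map_map, List.mem_map, List.mem_range, Function.comp_apply] at hg
  obtain ⟨i, hi, rfl⟩ := hg
  simp only [toSeg] at hx ⊢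
  exact hstep _ _ _ _ _ _ _ _ (hP i hi) ((x : ℂ) + (((b : ℝ) / 2 : ℝ) : ℂ) * I)
    (by rw [← hrowB i hi]; exact norm_sub_centre_horizontal _ _ _ hx)

/-- Step rules on the BOTTOM (conjugate) horizontal segments (edge `Im z = −b/2`). -/
theorem stepRule_hBot (hstep : StepRuleContract) {t : Array ℤ} {n : ℕ} {b : ℤ} {J : ℕ}
    (hrowB : ∀ i, i < n → rowB t i = b)
    (hP : ∀ i, i < n → PieceIneq (rowA t i) (rowB t i) (rowL t i) (rowD t i) (rowK t i) (rowN t i) J (rowX t i)) :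
    ∀ g ∈ (hBotI t n).map toSeg, ∀ x ∈ Icc g.1 g.2.1,
      0 < (canaryF ((x : ℂ) + (((-((b : ℝ) / 2) : ℝ)) : ℂ) * I) / I ^ g.2.2).re := by
  intro g hg x hx
  simp only [hBotI, List.map_map, List.mem_map, List.mem_range, Function.comp_apply] at hg
  obtain ⟨i, hi, rfl⟩ := hg
  simp only [toSeg] at hx ⊢
  have h := hstep _ _ _ _ _ _ _ _ (hP i hi) ((x : ℂ) + (((b : ℝ) / 2 : ℝ) : ℂ) * I)
    (by rw [← hrowB i hi]; exact norm_sub_centre_horizontal _ _ _ hx)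
  have hconj : conj ((x : ℂ) + (((b : ℝ) / 2 : ℝ) : ℂ) * I) = (x : ℂ) + (((-((b : ℝ) / 2) : ℝ)) : ℂ) * I := by
    simp only [map_add, map_mul, Complex.conj_ofReal, Complex.conj_I]; push_cast; ring
  rw [← re_conj_div_I_pow, ← canaryF_conj, hconj] at h
  exact h

end Summit.RiemannHypothesis.RiemannHypothesis.Theorems.JensenPolynomials.LogBand.Canary

end
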